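import Summits.BirchSwinnertonDyer.BirchSwinnertonDyer.Theorems.PrintCf2RubinValueTwoKatzFrameSupply
import Literature.NumberTheory.EllipticCurves.IntSeriesOnePlusPowExponentLaws
import HarnessLib

set_option linter.dupNamespace false
set_option autoImplicit false

/-!
# THE KATZ FRAME SUPPLY WITH ITS LINEAR STRUCTURE EXPOSED (every prime `p`): one node base `g` for all
# lines, directions `e(s) = a_s·d − d′` affine in the type slope `a_s = p(s + s₀ + 1)`

Cell `bsd-print-cf2`, width seat `bsd-line-cf2c-w3` g5, route C `PrintCf2RubinValueTwo`, `--supports stmt-BirchSwinnertonDyer-23722`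
(the «(R) period-rigidity» aside).  Theses-free; THEOREMS ONLY (no `def`, no named fact, no `sorry`); nothing is closed; BSD is not proved by
any of this; no summit statement is proved by this seat.

`KatzPeriodRigidity.exists_frameSupply₂` (g4, p699150) packages B18's split-prime line, directions and interpolation supply as data, but
HIDES the two facts the FULL (ideal) period-rigidity theorem needs in order to compare the line-wise binomial twists
`G'|_s = C₀·(1+T)^{z_s}·G|_s` ACROSS lines: (i) the node base is the SAME one-unit on every line — `u_s = g := χ₁(γ)` (`χ₁` the avatar of
`Ψ₁^W`, `γ` the generator of the split-prime line `κ`): `φ_s = χ₁^{a_s}(χ₁∘θ)⁻¹` has `φ_s(γ_s) = g^{a_sκ(γ_s) − κ(θγ_s)} = g^{κ_s(γ_s)} = g` by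
the exponent laws of `onePlusPow` (`IntSeriesOnePlusPowExponentLaws`); (ii) the directions are AFFINE in the type slope:
`κ_s(γ_i) = a_s·d_i − d_i′` with `d_i = κ(γ_i)`, `d_i′ = κ(θγ_i)`, `a_s = p(s + s₀ + 1)`, `d₁d₂′ ≠ d₂d₁′` (`exists_line_of_direction`,
`toAdd_mul_ne_of_isPAdicAvatarOf`).  **`exists_frameSupply₂_lin`** is `exists_frameSupply₂` with these conclusions added (same construction).

References: [deShalit1987] II.4.12 Remarks (iii)–(iv) (p. 66–67), II.4.16 (49)–(50), II.4.17 (52)–(54) (p. 77–78), II.6.4 (p. 85);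
[Washington1997] §5.1–§5.2, §13.
-/

noncomputable section

open scoped NumberField Classical Topology
open Filter NumberField IsDedekindDomain Field
open Literature Literature.NumberTheory.GaloisRepresentations Literature.NumberTheory.EllipticCurves
open Summit.BirchSwinnertonDyer.Rank1Residual.X11b Summit.BirchSwinnertonDyer.Rank1Residual.X11b.LambdaSupply
  Summit.BirchSwinnertonDyer.Rank1Residual.X11b.Three.LambdaSupply Summit.BirchSwinnertonDyer.BirchSwinnertonDyer.Theorems.PrintCf2
  Summit.BirchSwinnertonDyer.BirchSwinnertonDyer.Theorems.CycTangentCMCycTangentBoundUniquenessLines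
  Summit.BirchSwinnertonDyer.BirchSwinnertonDyer.Theorems.CycTangentCMCycTangentBoundInterpolationContinuation
  Summit.BirchSwinnertonDyer.BirchSwinnertonDyer.Theorems.CycTangentCMCycTangentBoundFrameUniqueness
  Summit.BirchSwinnertonDyer.BirchSwinnertonDyer.Theorems.CycTangentCMCycTangentBoundFrameUniquenessCM
  Summit.BirchSwinnertonDyer.BirchSwinnertonDyer.Theorems.CycTangentCMCycTangentBoundPeriodRigidity

namespace Summit.BirchSwinnertonDyer.BirchSwinnertonDyer.Theorems.PrintCf2.KatzPeriodRigidity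

variable {p : ℕ} [Fact p.Prime] {K : Type} [Field K] [NumberField K]

/-! ### §1 The supply with its linear structure -/

/-- **B18's frame supply with the linear structure exposed** (every prime `p`): lines `κF s` through the pair with generators `γF s` and
directions `κF s (γ_i) = p(s+s₀+1)·d_i − d_i′` (`d₁d₂′ ≠ d₂d₁′`), ONE one-unit `g ≠ 1` of level `< ‖p‖` serving as node base on EVERY line
(`r s t (γF s) = g^{t+1}`), characters `ρ s t` with avatars `r s t` through `κF s` putting `λρ s t` in de Shalit's cone with types
`m = a + NW·p(s+s₀+1)·(t+1)`, `j = b + NW·(t+1)`, unramified off `S ∪ {v̄}`, with entire `L`-functions.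
[cite: deShalit1987, II.4.16 (49)–(50) (p. 76–77), II.4.17 (52)–(54) (p. 77–78), II.6.4 proof (p. 85)] -/
theorem exists_frameSupply₂_lin (hK : IsImaginaryQuadratic K)
    {ι : PadicAlgCl p ≃+* ℂ} {v vbar : HeightOneSpectrum (𝓞 K)}
    (hv : ((p : ℕ) : 𝓞 K) ∈ v.asIdeal) (hvbar : ((p : ℕ) : 𝓞 K) ∈ vbar.asIdeal) (hne : vbar ≠ v)
    (hι : ∀ (w : InfinitePlace K) (d : 𝓞 K), d ∈ v.asIdeal ↔ ‖ι.symm (w.embedding (d : K))‖ < 1)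
    {S : Finset (HeightOneSpectrum (𝓞 K))}
    {η : HeckeCharacter K} {w₀ : ℕ} (hw₀ : 0 < w₀) (hη : η.HasInfinityType (fun _ ↦ (w₀ : ℤ)) (fun _ ↦ 0))
    {lam : HeckeCharacter K} {a b : ℕ} (hba : b ≤ a)
    (hlam : lam.HasInfinityType (fun _ ↦ -(a : ℤ)) (fun _ ↦ (b : ℤ)))
    (hlamu : ∀ w : HeightOneSpectrum (𝓞 K), w ∉ S → w ≠ vbar → lam.IsUnramifiedAt w)
    {κ₁ κ₂ : ZpExtension K p} {γ₁ γ₂ : absoluteGaloisGroup K}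
    (hpair : ZpExtension.IsTopGeneratorPair κ₁ κ₂ γ₁ γ₂) :
    ∃ (κF : ℕ → ZpExtension K p) (γF : ℕ → absoluteGaloisGroup K) (ρ : ℕ → ℕ → HeckeCharacter K)
      (r : ℕ → ℕ → FramedGaloisRep K (PadicAlgCl p) 1) (g : ℂ_[p]) (N W s₀ : ℕ) (d₁ d₂ d₁' d₂' : ℤ_[p]),
      0 < N ∧ 0 < W ∧ d₁ * d₂' ≠ d₂ * d₁' ∧
      (∀ s, ZpExtension.pairKer κ₁ κ₂ ≤ (κF s).kerSubgroup) ∧ (∀ s, (κF s).IsTopGenerator (γF s)) ∧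
      (∀ s, Multiplicative.toAdd (κF s γ₁) = ((p * (s + s₀ + 1) : ℕ) : ℤ_[p]) * d₁ - d₁') ∧
      (∀ s, Multiplicative.toAdd (κF s γ₂) = ((p * (s + s₀ + 1) : ℕ) : ℤ_[p]) * d₂ - d₂') ∧
      (∀ s, Multiplicative.toAdd (κF s γ₂) ≠ 0) ∧
      (∀ s t, s ≠ t → Multiplicative.toAdd (κF s γ₁) * Multiplicative.toAdd (κF t γ₂) ≠
        Multiplicative.toAdd (κF t γ₁) * Multiplicative.toAdd (κF s γ₂)) ∧
      ‖g - 1‖ < ‖(p : ℂ_[p])‖ ∧ g ≠ 1 ∧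
      ∀ s t, IsPAdicAvatarOf ι (ρ s t) (r s t) ∧ FactorsThroughZp (κF s) (r s t) ∧
        avatarValueAt (r s t) (γF s) = g ^ (t + 1) ∧
        (lam * ρ s t).HasInfinityType (fun _ ↦ -((a + N * (W * (p * (s + s₀ + 1) * (t + 1))) : ℕ) : ℤ))
          (fun _ ↦ ((b + N * (W * (t + 1)) : ℕ) : ℤ)) ∧
        b + N * (W * (t + 1)) < a + N * (W * (p * (s + s₀ + 1) * (t + 1))) ∧
        (∀ w : HeightOneSpectrum (𝓞 K), w ∉ S → w ≠ vbar → (lam * ρ s t).IsUnramifiedAt w) ∧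
        LFunction.HasEntireContinuation (heckeLFunction (lam * ρ s t)) := by
  haveI : Algebra.IsQuadraticExtension ℚ K := ⟨hK.1⟩
  haveI : IsGalois ℚ K := inferInstance
  haveI : IsCMField K := hK.isCMField
  haveI : IsTotallyComplex K := hK.2
  have himag : ∀ w : InfinitePlace K, w.IsComplex := fun w ↦ hK.2.isComplex w
  have hp : p.Prime := Fact.out
  set e := (FramedRep.unitsContinuousMulEquivOfUnique (Fin 1) (PadicAlgCl p) :
    (PadicAlgCl p)ˣ →ₜ* GL (Fin 1) (PadicAlgCl p)) with he
  -- Step 1: `Ψ₁ = η^{-N₀}`, type `(-N, 0)` with `N = w₀ N₀`, unramified everywhere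
  obtain ⟨N₁, hN₁, hηN⟩ := exists_pow_forall_isUnramifiedAt η
  set N : ℕ := N₁ * w₀ with hNdef
  have hN : 0 < N := Nat.mul_pos hN₁ hw₀
  set Ψ₁ : HeckeCharacter K := (η ^ N₁)⁻¹ with hΨ₁
  have hΨ₁t : Ψ₁.HasInfinityType (fun _ ↦ -(N : ℤ)) (fun _ ↦ 0) := by
    have h := (HasInfinityType.pow_nat hη N₁).inv
    convert h using 2 <;> simp [hNdef]
  have hΨ₁a : Ψ₁.IsAlgebraic :=
    (HeckeCharacter.isAlgebraic_iff_exists_hasInfinityType _).mpr ⟨_, _, hΨ₁t⟩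
  have hΨ₁u : ∀ w : HeightOneSpectrum (𝓞 K), Ψ₁.IsUnramifiedAt w := fun w ↦ (hηN w).inv'
  have hΨ₁pow_t : ∀ n : ℕ, (Ψ₁ ^ n).HasInfinityType (fun _ ↦ -((N * n : ℕ) : ℤ)) (fun _ ↦ 0) := by
    intro n
    have h := HasInfinityType.pow_nat hΨ₁t n
    convert h using 2 <;> push_cast <;> ring
  have hΨ₁pow_u : ∀ (n : ℕ) (w : HeightOneSpectrum (𝓞 K)), (Ψ₁ ^ n).IsUnramifiedAt w :=
    fun n w ↦ isUnramifiedAt_pow' (hΨ₁u w) n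
  -- Step 2: avatars of the powers of `Ψ₁` through the pair, tamed
  obtain ⟨M, χ₀, hM, hall⟩ := CycTangentCMCycTangentBoundPairSupply.exists_isPAdicAvatarOf_pow_factorsThroughPair
    ι hK.1 himag hΨ₁a (fun w _ ↦ hΨ₁u w) hpair
  obtain ⟨N₀, hN₀, hsmall₀⟩ := exists_pow_norm_sub_one_lt χ₀
  set χ₁ : absoluteGaloisGroup K →ₜ* (PadicAlgCl p)ˣ := χ₀ ^ N₀ with hχ₁
  set W : ℕ := M * N₀ with hW
  have hWpos : 0 < W := Nat.mul_pos hM hN₀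
  have havatar : ∀ n : ℕ, IsPAdicAvatarOf ι (Ψ₁ ^ (W * n)) (e.comp (χ₁ ^ n)) := by
    intro n
    have h := (hall (N₀ * n)).1
    rw [hχ₁, ← pow_mul, hW, mul_assoc]
    exact h
  have hpair_n : ∀ n : ℕ, FactorsThroughPair κ₁ κ₂ (e.comp (χ₁ ^ n)) := by
    intro n
    rw [hχ₁, ← pow_mul]
    exact (hall (N₀ * n)).2
  have hsmall : ∀ (n : ℕ) (σ : absoluteGaloisGroup K),
      ‖avatarValueAt (e.comp (χ₁ ^ n)) σ - 1‖ < ‖(p : ℂ_[p])‖ := by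
    intro n σ
    rw [he, avatarValueAt_unitsChar_pow]
    exact (UnrUnits.norm_pow_sub_one_le (norm_avatarValueAt_eq_one _ σ).le n).trans_lt (hsmall₀ σ)
  -- Step 3: the split-prime line `κ` carrying `χ₁`
  obtain ⟨κ, hκpair, hκinert, hsat⟩ := SplitPrimeLine.exists_splitPrimeLine_factorsThroughZp_of_split hK ι hv hvbar hne hι hpair
  have hχ₁κ' : FactorsThroughZp κ (e.comp χ₁) := by
    have h := hsat (Ψ₁ ^ (W * 1)) (-((N * (W * 1) : ℕ) : ℤ)) ∅ (e.comp (χ₁ ^ 1)) (hΨ₁pow_t _)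
      (fun w _ ↦ hΨ₁pow_u _ w) (hΨ₁pow_u _ vbar) (havatar 1) (hpair_n 1) (hsmall 1)
    rwa [pow_one] at h
  have hχ₁κ : ∀ σ, κ σ = 1 → χ₁ σ = 1 := (factorsThroughZp_unitsChar_iff κ χ₁).mp hχ₁κ'
  set γ : absoluteGaloisGroup K := κ.lift 1 with hγdef
  have hγ : κ.IsTopGenerator γ := κ.apply_lift 1
  -- Step 4: complex conjugation, its outer action `θ`
  obtain ⟨c, hc, hc2⟩ := exists_not_mem_range_absGaloisRestrict (K := ℚ) (L := K) (Rat.castHom ℝ) himag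
  set θ := absGaloisOuterConj ℚ K c with hθ
  have hθθ : ∀ σ, θ (θ σ) = σ := fun σ ↦ by
    rw [hθ, ← absGaloisOuterConj_mul_apply, hc2, absGaloisOuterConj_one_apply]
  have hθres : ∀ σ, absGaloisRestrict ℚ K (θ σ) = c * absGaloisRestrict ℚ K σ * c⁻¹ :=
    fun σ ↦ absGaloisRestrict_absGaloisOuterConj ℚ K c σ
  -- Step 5: non-degeneracy of the directions of `κ`, `κ ∘ θ`
  have hNW : (-((N * (W * 1) : ℕ) : ℤ)) ≠ 0 := by
    have : 0 < N * (W * 1) := Nat.mul_pos hN (by omega)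
    omega
  have havatar1 : IsPAdicAvatarOf ι (Ψ₁ ^ (W * 1)) (e.comp χ₁) := by
    have h := havatar 1; rwa [pow_one] at h
  have hdet := toAdd_mul_ne_of_isPAdicAvatarOf ι hK hv hvbar hne hι hpair hκinert hNW (hΨ₁pow_t _)
    (hΨ₁pow_u _) havatar1 hχ₁κ hc
  set d₁ := Multiplicative.toAdd (κ γ₁) with hd₁
  set d₂ := Multiplicative.toAdd (κ γ₂) with hd₂
  set d₁' := Multiplicative.toAdd (κ (θ γ₁)) with hd₁'
  set d₂' := Multiplicative.toAdd (κ (θ γ₂)) with hd₂'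
  -- Step 6: the lines
  have hlines := fun s : ℕ ↦ exists_line_of_direction (p := p) hK hpair hκpair hγ θ hθθ (s + 1)
  choose κL γL hκLpair hγL hκLval hκLchar using hlines
  -- at most one line has `κ_s(γ₂) = 0`: shift past it
  have hval2 : ∀ s, Multiplicative.toAdd (κL s γ₂) = ((p * (s + 1) : ℕ) : ℤ_[p]) * d₂ - d₂' :=
    fun s ↦ hκLval s γ₂
  have hval1 : ∀ s, Multiplicative.toAdd (κL s γ₁) = ((p * (s + 1) : ℕ) : ℤ_[p]) * d₁ - d₁' :=
    fun s ↦ hκLval s γ₁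
  have huniq : ∀ s t, Multiplicative.toAdd (κL s γ₂) = 0 → Multiplicative.toAdd (κL t γ₂) = 0 → s = t := by
    intro s t hs ht
    rw [hval2] at hs ht
    by_contra hst
    have hd2 : d₂ = 0 := by
      have h1 : (((p * (s + 1) : ℕ) : ℤ_[p]) - ((p * (t + 1) : ℕ) : ℤ_[p])) * d₂ = 0 := by
        linear_combination hs - ht
      rcases mul_eq_zero.mp h1 with h | h
      · exfalso
        have : ((p * (s + 1) : ℕ) : ℤ_[p]) = ((p * (t + 1) : ℕ) : ℤ_[p]) := sub_eq_zero.mp h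
        have h2 : p * (s + 1) = p * (t + 1) := by exact_mod_cast this
        have := Nat.eq_of_mul_eq_mul_left hp.pos h2
        omega
      · exact h
    have hd2' : d₂' = 0 := by rw [hd2, mul_zero, zero_sub, neg_eq_zero] at hs; exact hs
    apply hdet
    rw [hd2, hd2', mul_zero, zero_mul]
  obtain ⟨shift, hshift⟩ : ∃ shift : ℕ, ∀ s, Multiplicative.toAdd (κL (s + shift) γ₂) ≠ 0 := by
    by_cases hbad : ∃ s₀, Multiplicative.toAdd (κL s₀ γ₂) = 0
    · obtain ⟨s₀, hs₀⟩ := hbad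
      refine ⟨s₀ + 1, fun s hs ↦ ?_⟩
      have := huniq _ _ hs hs₀
      omega
    · push Not at hbad
      exact ⟨0, fun s ↦ hbad _⟩
  -- the final family
  set κF : ℕ → ZpExtension K p := fun s ↦ κL (s + shift) with hκF
  set γF : ℕ → absoluteGaloisGroup K := fun s ↦ γL (s + shift) with hγF
  set aF : ℕ → ℕ := fun s ↦ p * (s + shift + 1) with haF
  have haFpos : ∀ s, 0 < aF s := fun s ↦ Nat.mul_pos hp.pos (Nat.succ_pos _)
  have hprop : ∀ s t, s ≠ t → Multiplicative.toAdd (κF s γ₁) * Multiplicative.toAdd (κF t γ₂) ≠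
      Multiplicative.toAdd (κF t γ₁) * Multiplicative.toAdd (κF s γ₂) := by
    intro s t hst heq
    simp only [hκF, hval1, hval2] at heq
    have key : (((p * (s + shift + 1) : ℕ) : ℤ_[p]) - ((p * (t + shift + 1) : ℕ) : ℤ_[p])) *
        (d₁' * d₂ - d₁ * d₂') = 0 := by
      linear_combination heq
    rcases mul_eq_zero.mp key with h | h
    · have : ((p * (s + shift + 1) : ℕ) : ℤ_[p]) = ((p * (t + shift + 1) : ℕ) : ℤ_[p]) := sub_eq_zero.mp h
      have h2 : p * (s + shift + 1) = p * (t + shift + 1) := by exact_mod_cast this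
      have := Nat.eq_of_mul_eq_mul_left hp.pos h2
      omega
    · exact hdet (by linear_combination -h)
  -- Step 7: the characters `φ_s = χ₁^{a_s} (χ₁∘θ)⁻¹` through `κF s`
  set φ : ℕ → (absoluteGaloisGroup K →ₜ* (PadicAlgCl p)ˣ) :=
    fun s ↦ χ₁ ^ (aF s) * (χ₁.comp θ)⁻¹ with hφdef
  have hφκ : ∀ s, FactorsThroughZp (κF s) (e.comp (φ s)) := fun s ↦
    (factorsThroughZp_unitsChar_iff (κF s) (φ s)).mpr (hκLchar (s + shift) χ₁ hχ₁κ)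
  have hφpow : ∀ s n, (φ s) ^ n = χ₁ ^ (aF s * n) * ((χ₁ ^ n).comp θ)⁻¹ := by
    intro s n
    refine ContinuousMonoidHom.ext fun σ ↦ ?_
    simp only [hφdef, ContinuousMonoidHom.pow_apply, ContinuousMonoidHom.mul_apply, unitsChar_inv_apply,
      ContinuousMonoidHom.coe_comp, Function.comp_apply, mul_pow, inv_pow, pow_mul]
  -- small values of `φ_s`
  have hφsmall : ∀ s σ, ‖avatarValueAt (e.comp (φ s)) σ - 1‖ < ‖(p : ℂ_[p])‖ := by
    intro s σ
    have h1 := hsmall (aF s) σ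
    have h2 := hsmall 1 (θ σ)
    rw [pow_one] at h2
    rw [hφdef, he, avatarValueAt_unitsChar_mul, ← he]
    have e3 : avatarValueAt (e.comp (χ₁.comp θ)⁻¹) σ = (avatarValueAt (e.comp χ₁) (θ σ))⁻¹ := by
      rw [he, avatarValueAt_unitsChar, avatarValueAt_unitsChar, unitsChar_inv_apply,
        ContinuousMonoidHom.coe_comp, Function.comp_apply, Units.val_inv_eq_inv_val, PadicComplex.coe_eq,
        PadicComplex.coe_eq, map_inv₀]
    rw [e3]
    exact norm_mul_inv_sub_one_lt (norm_avatarValueAt_eq_one _ _) h1 h2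
  -- `φ_s(γ_s)` is a principal unit, not `1`
  have hφne : ∀ s, avatarValueAt (e.comp (φ s)) (γF s) ≠ 1 := by
    intro s h1
    -- then `φ_s ≡ 1`
    have hall1 : ∀ σ, avatarValueAt (e.comp (φ s)) σ = 1 := fun σ ↦ by
      rw [ZpExtension.avatarValueAt_eq_onePlusPow (hφκ s) (hγL (s + shift)) σ, h1, sub_self]
      have h := IntSeries.norm_onePlusPow_sub_one_le (Multiplicative.toAdd (κF s σ)) (x := (0 : ℂ_[p]))
        (by rw [norm_zero]; exact one_pos)
      rw [norm_zero] at h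
      exact sub_eq_zero.mp (norm_le_zero_iff.mp h)
    -- hence `χ₁` kills `θ(I_𝔓)` for `𝔓 ∣ v̄`: `e∘χ₁` unramified at `v`
    have hχθ : ∀ 𝔓 ∈ vbar.primesAbove, ∀ τ ∈ 𝔓.inertia (absoluteGaloisGroup K), χ₁ (θ τ) = 1 := by
      intro 𝔓 h𝔓 τ hτ
      have hκτ : κ τ = 1 := ZpExtension.mem_kerSubgroup.mp (hκinert 𝔓 h𝔓 hτ)
      have hχτ : χ₁ τ = 1 := hχ₁κ τ hκτ
      have h := hall1 τ
      rw [he, avatarValueAt_unitsChar, hφdef, ContinuousMonoidHom.mul_apply, ContinuousMonoidHom.pow_apply,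
        hχτ, one_pow, one_mul, unitsChar_inv_apply, ContinuousMonoidHom.coe_comp, Function.comp_apply,
        ← UniformSpace.Completion.coe_one, UniformSpace.Completion.coe_inj] at h
      exact inv_eq_one.mp (Units.ext h)
    have hunrθ : (FramedGaloisRep.outerConj c (e.comp χ₁)).IsUnramifiedAt vbar := by
      intro 𝔓 h𝔓 τ hτ
      rw [FramedGaloisRep.outerConj_apply, ← hθ, ContinuousMonoidHom.coe_comp, Function.comp_apply,
        hχθ 𝔓 h𝔓 τ hτ, map_one]
    have hcbar : absGaloisQuot ℚ K c ≠ 1 := fun h1 ↦ by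
      obtain ⟨x, hx⟩ := (absGaloisQuot_eq_one_iff ℚ K c).1 h1
      exact hc ⟨x, hx⟩
    have hunrv : FramedGaloisRep.IsUnramifiedAt v (e.comp χ₁) := by
      have h := (FramedGaloisRep.isUnramifiedAt_outerConj_iff c (e.comp χ₁) vbar).mp hunrθ
      rwa [CycTangentCMCycTangentBoundAvatarRamified.smul_eq_of_ne_one hK.1 hv hvbar hne hcbar] at h
    exact CycTangentCMCycTangentBoundAvatarRamified.not_isUnramifiedAt_avatar_of_hasInfinityType_ne_zero ι hK
      hv hvbar hne hι hNW (hΨ₁pow_t _) (T := ∅) (fun w _ ↦ hΨ₁pow_u _ w) (hΨ₁pow_u _ v) havatar1 hunrv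
  -- Step 8 (this file): the supply through ALL `t ≥ 1`, indexed by `t + 1`
  set ρ : ℕ → ℕ → HeckeCharacter K := fun s t ↦
    Ψ₁ ^ (W * (aF s * (t + 1))) * (HeckeCharacter.galConj (IsCMField.complexConj K) (Ψ₁ ^ (W * (t + 1))))⁻¹
    with hρdef
  set r : ℕ → ℕ → FramedGaloisRep K (PadicAlgCl p) 1 := fun s t ↦ e.comp ((φ s) ^ (t + 1)) with hrdef
  set m : ℕ → ℕ → ℕ := fun s t ↦ a + N * (W * (aF s * (t + 1))) with hmdef
  set j : ℕ → ℕ → ℕ := fun s t ↦ b + N * (W * (t + 1)) with hjdef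
  have hr : ∀ s t, IsPAdicAvatarOf ι (ρ s t) (r s t) := by
    intro s t
    have h1 : IsPAdicAvatarOf ι (Ψ₁ ^ (W * (aF s * (t + 1)))) (e.comp (χ₁ ^ (aF s * (t + 1)))) := havatar _
    have h2 : IsPAdicAvatarOf ι (HeckeCharacter.galConj (IsCMField.complexConj K) (Ψ₁ ^ (W * (t + 1))))
        (e.comp ((χ₁ ^ (t + 1)).comp θ)) := by
      have h := isPAdicAvatarOf_galConj_complexConj_comp hK.1 ι (havatar (t + 1)) hc hθres
      exact h
    have h3 := isPAdicAvatarOf_mul ι h1 (isPAdicAvatarOf_inv ι h2)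
      (hram_of_forall (fun w _ ↦ hΨ₁pow_u _ w) (fun w _ ↦ ?_))
    · rw [hrdef, hρdef]
      simp only
      rw [hφpow s (t + 1)]
      exact h3
    · rw [← inv_inv (HeckeCharacter.galConj _ _)]
      refine HeckeCharacter.IsUnramifiedAt.inv' ?_
      rw [inv_inv, HeckeCharacter.isUnramifiedAt_galConj_iff]
      exact hΨ₁pow_u _ _
  have hκr : ∀ s t, FactorsThroughZp (κF s) (r s t) := fun s t ↦ factorsThroughZp_unitsChar_pow _ (hφκ s) _
  have haF2 : ∀ s, 2 ≤ aF s := fun s ↦ by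
    have h2 : 2 ≤ p := hp.two_le
    show 2 ≤ p * (s + shift + 1)
    nlinarith
  have hjm : ∀ s t, j s t < m s t := by
    intro s t
    have h1 : 2 * (W * (t + 1)) ≤ W * (aF s * (t + 1)) := by
      have := Nat.mul_le_mul_left (W * (t + 1)) (haF2 s)
      nlinarith
    have h2 : N * (2 * (W * (t + 1))) ≤ N * (W * (aF s * (t + 1))) := Nat.mul_le_mul_left _ h1
    have h3 : 0 < N * (W * (t + 1)) := Nat.mul_pos hN (Nat.mul_pos hWpos (Nat.succ_pos t))
    show b + N * (W * (t + 1)) < a + N * (W * (aF s * (t + 1)))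
    nlinarith
  have hinf : ∀ s t, (lam * ρ s t).HasInfinityType (fun _ ↦ -(m s t : ℤ)) (fun _ ↦ (j s t : ℤ)) := by
    intro s t
    have h := hlam.mul' ((hΨ₁pow_t (W * (aF s * (t + 1)))).mul'
      ((hΨ₁pow_t (W * (t + 1))).galConj_complexConj.inv))
    show (lam * (Ψ₁ ^ (W * (aF s * (t + 1))) *
        (HeckeCharacter.galConj (IsCMField.complexConj K) (Ψ₁ ^ (W * (t + 1))))⁻¹)).HasInfinityType
      (fun _ ↦ -((a + N * (W * (aF s * (t + 1))) : ℕ) : ℤ)) (fun _ ↦ ((b + N * (W * (t + 1)) : ℕ) : ℤ))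
    convert h using 2 <;> simp only [Pi.add_apply, Pi.neg_apply] <;> push_cast <;> ring
  have hunr : ∀ s t (w : HeightOneSpectrum (𝓞 K)), w ∉ S → w ≠ vbar → (lam * ρ s t).IsUnramifiedAt w := by
    intro s t w hw hwv
    refine (hlamu w hw hwv).mul' ((hΨ₁pow_u _ w).mul' ?_)
    rw [← inv_inv (HeckeCharacter.galConj _ _)]
    refine HeckeCharacter.IsUnramifiedAt.inv' ?_
    rw [inv_inv, HeckeCharacter.isUnramifiedAt_galConj_iff]
    exact hΨ₁pow_u _ _
  have hL : ∀ s t, LFunction.HasEntireContinuation (heckeLFunction (lam * ρ s t)) :=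
    fun s t ↦ hasEntireContinuation_of_hasInfinityType hK (hjm s t) (hinf s t)
  -- the COMMON node base `g = χ₁(γ)`: `φ_s(γF s) = g^{κF s (γF s)} = g`
  set g : ℂ_[p] := avatarValueAt (e.comp χ₁) γ with hgdef
  have hp1 : ‖(p : ℂ_[p])‖ ≤ 1 := norm_prime_padicComplex_lt_one.le
  have hgsmall : ‖g - 1‖ < ‖(p : ℂ_[p])‖ := by
    have h := hsmall 1 γ
    rwa [pow_one] at h
  have hg1 : ‖g - 1‖ < 1 := hgsmall.trans_le hp1
  have hχ₁val : ∀ σ, avatarValueAt (e.comp χ₁) σ = IntSeries.onePlusPow (Multiplicative.toAdd (κ σ)) (g - 1) :=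
    fun σ ↦ ZpExtension.avatarValueAt_eq_onePlusPow hχ₁κ' hγ σ
  have hφval : ∀ s σ, avatarValueAt (e.comp (φ s)) σ =
      IntSeries.onePlusPow (Multiplicative.toAdd (κF s σ)) (g - 1) := by
    intro s σ
    have e3 : avatarValueAt (e.comp (χ₁.comp θ)⁻¹) σ = (avatarValueAt (e.comp χ₁) (θ σ))⁻¹ := by
      rw [he, avatarValueAt_unitsChar, avatarValueAt_unitsChar, unitsChar_inv_apply,
        ContinuousMonoidHom.coe_comp, Function.comp_apply, Units.val_inv_eq_inv_val, PadicComplex.coe_eq,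
        PadicComplex.coe_eq, map_inv₀]
    have epow : avatarValueAt (e.comp (χ₁ ^ aF s)) σ = (avatarValueAt (e.comp χ₁) σ) ^ aF s := by
      rw [he, avatarValueAt_unitsChar_pow]
    have emul : avatarValueAt (e.comp (φ s)) σ =
        avatarValueAt (e.comp (χ₁ ^ aF s)) σ * avatarValueAt (e.comp (χ₁.comp θ)⁻¹) σ := by
      rw [hφdef, he, avatarValueAt_unitsChar_mul]
    rw [emul, epow, e3, hχ₁val, hχ₁val, ← IntSeries.onePlusPow_natCast_mul _ _ hg1, ← IntSeries.onePlusPow_neg _ hg1,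
      ← IntSeries.onePlusPow_add _ _ hg1]
    congr 1
    simp only [hκF, haF, hκLval]
    ring
  have hu : ∀ s, avatarValueAt (e.comp (φ s)) (γF s) = g := by
    intro s
    rw [hφval, show Multiplicative.toAdd (κF s (γF s)) = 1 by
      rw [show κF s (γF s) = Multiplicative.ofAdd 1 from hγL (s + shift)]; rfl, IntSeries.onePlusPow_one,
      add_sub_cancel]
  have hrval : ∀ s t, avatarValueAt (r s t) (γF s) = g ^ (t + 1) :=
    fun s t ↦ by rw [hrdef, he, avatarValueAt_unitsChar_pow, ← he, hu]
  have hgne : g ≠ 1 := by rw [← hu 0]; exact hφne 0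
  refine ⟨κF, γF, ρ, r, g, N, W, shift, d₁, d₂, d₁', d₂', hN, hWpos, hdet, fun s ↦ hκLpair _, fun s ↦ hγL _,
    fun s ↦ ?_, fun s ↦ ?_, hshift, hprop, hgsmall, hgne,
    fun s t ↦ ⟨hr s t, hκr s t, hrval s t, hinf s t, hjm s t, hunr s t, hL s t⟩⟩
  · simp only [hκF, hval1]
  · simp only [hκF, hval2]

end Summit.BirchSwinnertonDyer.BirchSwinnertonDyer.Theorems.PrintCf2.KatzPeriodRigidity

end
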